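import Summits.CriticalPhenomena.PercolationContinuityZ3.Theorems.Transplant.FKDoubleFanOneSidedConeSRelabel
import HarnessLib

/-!
# Double fans `K₂ ∨ P_{m+1}`: the exact criterion HOLDS on the corner cell {cut gadgets} × {`P_b`-type rests} — a derivative certificate in the kernel

Helper file (`--supports stmt-CriticalPhenomena-4575`), FK sub-lane `prim-bschramm-fk-3` (gen 39); builds on p205010 (kernel theorem, internal audit
signed; external expert review pending).  No named facts, no sorries; standard axioms.  Memo `bschramm/prim-bschramm-fk-3/FAR-CROSS-XIV.md` §0(B).

`…ConeSCross`/`…ConeSSigns` reduce `HypBaS q` (hence the far cross-apex theorem for all middles) to CROSS-POSITIVITY of `T_b`: `⟪T_b β, ρ⟫ ≥ 0` whenever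
`β` is in the closure of the normalised `a`-images, `ρ ∈ OSDualS q` and `⟪β, ρ⟫ = 0`.  This file discharges it on the first cell — the one where the
uniform shifted targets `(T_b + C)·β` of `…ConeSShift` are boundary points of the cone for every `C` (memo XIII §6bis) —, by the DERIVATIVE mechanism of
memo XIV: for the cut gadgets `F = edgeAB x = (1−x, x, 0, 0, 0)` (`Comb(F) = D ∘ AC_x`) on the `P_b`-type rests `w = BC_1 ∗ edgeAB t = (0,0,0,1−t,t)`,
the genuine gadgets `Z_s := rimStep s (BC_x ∗ AC_1) = (1−s)·F + s·G`, `G = (0, 0, 1−x, 0, x)`, satisfy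
  `imgA Z_s w = (1−s)²·imgA F w + s(1−s)·T_b (imgA F w) + s²·imgA G w`   (**`imgA_rimStep_cut_pinB`**, from `opTb_imgA_cut_eq_polar`),
so `⟪imgA F w, ρ⟫ = 0` and `ρ ∈ OSDualS q` give `(1−s)⟪T_b (imgA F w), ρ⟫ + s⟪imgA G w, ρ⟫ ≥ 0` for all `s ∈ (0,1)`, whence
**`crossPos_cut_pinB`**: `0 ≤ ⟪T_b (imgA F w), ρ⟫` (`0 < q ≤ 1`, `x, t ∈ [0,1]`).  [The corner `d = d1∧d2` of memo XIII is `x = 0`, `t = 0`.]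
[folklore]
-/

noncomputable section

namespace Summit.CriticalPhenomena.PercolationContinuityZ3.Theorems

namespace FK

namespace ThreeApex

/-- The gadget path `Z_s = rimStep s (BC_x ∗ AC_1)` through the cut gadget `edgeAB x` (`s = 0`) in the direction `G = (0,0,1−x,0,x)` (`s = 1`). [folklore] -/
theorem rimStep_conv_edgeBC_edgeAC_one (q s x : ℝ) :
    rimStep q s (conv (edgeBC x) (edgeAC 1)) = ⟨(1 - s) * (1 - x), (1 - s) * x, s * (1 - x), 0, s * x⟩ := by
  ext <;> simp [rimStep, conv, edgeBC, edgeAC, V5.total]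

/-- The `P_b`-type rest `BC_1 ∗ edgeAB t = (0, 0, 0, 1−t, t)`. [folklore] -/
theorem conv_edgeBC_one_edgeAB (t : ℝ) : conv (edgeBC 1) (edgeAB t) = ⟨0, 0, 0, 1 - t, t⟩ := by
  ext <;> simp [conv, edgeBC, edgeAB, V5.total]

/-- **The atom path through the corner cell is the `T_b`-parabola**: `imgA Z_s w = (1−s)²·a + s(1−s)·T_b a + s²·imgA G w` for the cut gadget
`a = imgA (edgeAB x) w` on a `P_b`-type rest `w = (0,0,0,b,c)`. [folklore] -/
theorem imgA_rimStep_cut_pinB (q s x b c : ℝ) :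
    imgA q (rimStep q s (conv (edgeBC x) (edgeAC 1))) ⟨0, 0, 0, b, c⟩ =
      Biv.lin3 ((1 - s) ^ 2) (imgA q (edgeAB x) ⟨0, 0, 0, b, c⟩) (s * (1 - s)) (opTb (imgA q (edgeAB x) ⟨0, 0, 0, b, c⟩))
        (s ^ 2) (imgA q ⟨0, 0, 1 - x, 0, x⟩ ⟨0, 0, 0, b, c⟩) := by
  rw [rimStep_conv_edgeBC_edgeAC_one]
  ext <;> simp only [imgA, wedgeH, fanCombo, conv, edgeAC, edgeAB, detach, V5.total, hx, hy, hz, opTb, Biv.lin3, Biv.add, Biv.smul] <;> ring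

/-- From `(1−s)·T + s·R ≥ 0` for all `s ∈ (0,1)`: `T ≥ 0`. [folklore] -/
theorem nonneg_of_convex_comb_nonneg {T R : ℝ} (h : ∀ s : ℝ, 0 < s → s < 1 → 0 ≤ (1 - s) * T + s * R) : 0 ≤ T := by
  by_contra hT
  rw [not_le] at hT
  by_cases hR : R ≤ 0
  · have := h (1 / 2) (by norm_num) (by norm_num); nlinarith
  · rw [not_le] at hR
    have hRT : 0 < R - T := by linarith
    set s : ℝ := -T / (2 * (R - T)) with hs
    have hs0 : 0 < s := by rw [hs]; exact div_pos (by linarith) (by linarith)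
    have hs1 : s ≤ 1 / 2 := by rw [hs, div_le_iff₀ (by linarith)]; linarith
    have := h s hs0 (by linarith)
    have e : (1 - s) * T + s * R = T + s * (R - T) := by ring
    have e2 : s * (R - T) = -T / 2 := by rw [hs]; field_simp
    rw [e, e2] at this
    linarith

/-- **Cross-positivity of `T_b` on the corner cell** {cut gadgets `edgeAB x`} × {`P_b`-type rests `BC_1 ∗ edgeAB t`} (`0 < q ≤ 1`): for every
`ρ ∈ OSDualS q` vanishing at the atom, `⟪T_b (imgA F w), ρ⟫ ≥ 0` — the exact criterion of `…ConeSCross` holds on this cell. [folklore] -/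
theorem crossPos_cut_pinB {q : ℝ} (hq0 : 0 < q) (hq1 : q ≤ 1) {x t : ℝ} (hx0 : 0 ≤ x) (hx1 : x ≤ 1) (ht0 : 0 ≤ t) (ht1 : t ≤ 1)
    {ρ : Biv} (hρ : OSDualS q ρ) (h0 : pairH q (imgA q (edgeAB x) (conv (edgeBC 1) (edgeAB t))) ρ = 0) :
    0 ≤ pairH q (opTb (imgA q (edgeAB x) (conv (edgeBC 1) (edgeAB t)))) ρ := by
  have hw : InS q (conv (edgeBC 1) (edgeAB t)) := ((IsLetter.ab ht0 ht1).inS hq0 hq1).step hq0 hq1 (IsLetter.bc zero_le_one le_rfl)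
  have hG : InS q (conv (edgeBC x) (edgeAC 1)) := ((IsLetter.ac zero_le_one le_rfl).inS hq0 hq1).step hq0 hq1 (IsLetter.bc hx0 hx1)
  refine nonneg_of_convex_comb_nonneg (R := pairH q (imgA q ⟨0, 0, 1 - x, 0, x⟩ (conv (edgeBC 1) (edgeAB t))) ρ) fun s hs0 hs1 => ?_
  have hZ : InS q (rimStep q s (conv (edgeBC x) (edgeAC 1))) := hG.rimStep hq0 hq1 hs0.le hs1.le
  have key := hρ _ _ hZ hw
  rw [conv_edgeBC_one_edgeAB, imgA_rimStep_cut_pinB, pairH_lin3_left] at key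
  rw [conv_edgeBC_one_edgeAB] at h0 ⊢
  rw [h0, mul_zero, zero_add] at key
  have e : s * (1 - s) * pairH q (opTb (imgA q (edgeAB x) ⟨0, 0, 0, 1 - t, t⟩)) ρ
      + s ^ 2 * pairH q (imgA q ⟨0, 0, 1 - x, 0, x⟩ ⟨0, 0, 0, 1 - t, t⟩) ρ =
      s * ((1 - s) * pairH q (opTb (imgA q (edgeAB x) ⟨0, 0, 0, 1 - t, t⟩)) ρ + s * pairH q (imgA q ⟨0, 0, 1 - x, 0, x⟩ ⟨0, 0, 0, 1 - t, t⟩) ρ) := by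
    ring
  rw [e] at key
  exact (mul_nonneg_iff_of_pos_left hs0).1 key

/-- The same at every point of the CLOSURE that is such an atom: the criterion's quantifier form (`atomClosure` points equal to a normalised corner
atom are covered since `pairH` and `opTb` are linear). [folklore] -/
theorem crossPos_cut_pinB_smul {q : ℝ} (hq0 : 0 < q) (hq1 : q ≤ 1) {x t : ℝ} (hx0 : 0 ≤ x) (hx1 : x ≤ 1) (ht0 : 0 ≤ t) (ht1 : t ≤ 1)
    {c : ℝ} (hc : 0 ≤ c) {ρ : Biv} (hρ : OSDualS q ρ)
    (h0 : pairH q (Biv.smul c (imgA q (edgeAB x) (conv (edgeBC 1) (edgeAB t)))) ρ = 0) :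
    0 ≤ pairH q (opTb (Biv.smul c (imgA q (edgeAB x) (conv (edgeBC 1) (edgeAB t))))) ρ := by
  rcases hc.eq_or_lt with rfl | hc'
  · have h00 : ∀ β : Biv, opTb (Biv.smul 0 β) = Biv.smul 0 β := fun β => by
      ext <;> simp [opTb, Biv.smul]
    rw [h00, pairH_smul_left, zero_mul]
  · have hT : ∀ β : Biv, opTb (Biv.smul c β) = Biv.smul c (opTb β) := fun β => by
      ext <;> simp only [opTb, Biv.smul] <;> ring
    rw [pairH_smul_left] at h0
    rw [hT, pairH_smul_left]
    exact mul_nonneg hc (crossPos_cut_pinB hq0 hq1 hx0 hx1 ht0 ht1 hρ ((mul_eq_zero.1 h0).resolve_left hc'.ne'))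

end ThreeApex

end FK

end Summit.CriticalPhenomena.PercolationContinuityZ3.Theorems
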